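import Summits.Ventures.Crystal3D.Theorems.StickyWulffConstantCoaxialWallLawEndRowOnSiteDefsA
import Summits.Ventures.Crystal3D.Theorems.StickyWulffConstantCoaxialWallLawBarlowWindowFrames
import Summits.Ventures.Crystal3D.Theorems.StickyWulffConstantCoaxialWallLawClassCollapse
import Summits.Ventures.Crystal3D.Theorems.StickyWulffConstantCoaxialWallLawSigInvariance
import Summits.Ventures.Crystal3D.Theorems.StickyWulffConstantCoaxialWallLawEndRowTail
import Summits.Ventures.Crystal3D.Theorems.StickyWulffConstantCoaxialWallLawWordTransPlane
import Summits.Ventures.Crystal3D.Theorems.StickyWulffConstantCoaxialWallLawInPlaneSix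
import Summits.Ventures.Crystal3D.Theorems.StickyWulffConstantCoaxialWallLawTwinWord
import HarnessLib

/-!
# Tools for the on-site bridge: the two standard frames, the model normals, basal sectors
# (crux `CoaxialWallLaw`, stmt-Ventures-19481, line `WallLedgerF`)

HONEST FRAMING. Venture `Summits/Ventures/Crystal3D` (cell `crystal3d-full`), helper `--supports` the crux
`CoaxialWallLaw` (stmt-Ventures-19481, `route-Ventures-StickyWulffConstant`), REGISTERED line `WallLedgerF` (planner
cf-p1).  Rung credit; F-C1 not moved; census-free bookkeeping for the bridge «on-site fact (`EndRowOnSiteA`,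
`…EndRowOnSiteDefsA`) ⇒ typed rows at on-site windows» (cf-p1 ORDER 2026-08-28T21:28:15Z item (2)).

* `mem_modelNormals_of_menu` — a unit model menu normal is one of the eight `modelNormals` (it is the normalised sum
  of its far face: equality in Cauchy–Schwarz);
* `sigFrame_not_apply`, `image_sigFrame_not`, `sigFrame_symm_apply`, `sigFrame_of_basal`,
  `sigFrame_apply_two_eq_zero_iff`, `image_sigFrame_std`, `exists_sigFrame_of_std`, `norm_sigDir` — the two standard
  frames `sigFrame ε`;
* `PlateSystem.fw_eq_of_G₀` — the frames of a plate system depend on its base frame only;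
  `inPlaneRoots_subset_basalHexagon`, `halfTurn_of_basal`, `inPlaneRoots_halfTurn` (the top plate's falling roots
  are the bottom plate's rising roots, as model sets);
* `exists_sector_of_halfplane` — the basal slots on the positive side of ANY vector lie in one `basalSector h`
  (a maximiser `h`; two basal slots are never orthogonal, and a `120°` pair would sum to a better slot).
WHAT THIS IS NOT: not the domination, not the bridge; F-C1 not moved.
-/


noncomputable section

namespace Summit.Ventures.Crystal3D.Theorems

open Summit.Ventures.Crystal3D Finset
open Literature.MathematicalPhysics.StatisticalMechanics (barlowPos barlowStacking fccStacking constHagg IsHaggSeq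
  basalMirror basalMirror_apply_coord basalMirror_basalMirror triangularVec₁ barlowPos_apply_two)
open scoped InnerProductSpace

/-! ### Bookkeeping of the standard frames and the model normals -/

/-- **A unit model menu normal is a face normal**, hence one of the eight `modelNormals`. -/
theorem mem_modelNormals_of_menu {n : EuclideanSpace ℝ (Fin 3)} (hn : ‖n‖ = 1)
    (hmenu : ∀ w ∈ fccSlots, ⟪w, n⟫_ℝ = 0 ∨ ⟪w, n⟫_ℝ = Real.sqrt (2 / 3) ∨ ⟪w, n⟫_ℝ = -Real.sqrt (2 / 3)) :
    n ∈ modelNormals := by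
  classical
  have hmenu' : ∀ w ∈ fccSlots,
      ⟪(LinearIsometryEquiv.refl ℝ (EuclideanSpace ℝ (Fin 3))) w, n⟫_ℝ = 0 ∨
      ⟪(LinearIsometryEquiv.refl ℝ (EuclideanSpace ℝ (Fin 3))) w, n⟫_ℝ = Real.sqrt (2 / 3) ∨
      ⟪(LinearIsometryEquiv.refl ℝ (EuclideanSpace ℝ (Fin 3))) w, n⟫_ℝ = -Real.sqrt (2 / 3) := by
    intro w hw; simpa using hmenu w hw
  obtain ⟨a, ha, b, hb, c, hc, hna, hnb, hnc, hab, hac, hbc, -, -⟩ :=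
    exists_far_frame (LinearIsometryEquiv.refl ℝ _) hn hmenu'
  simp only [LinearIsometryEquiv.coe_refl, id_eq] at hna hnb hnc
  have h6 : 0 < Real.sqrt 6 := Real.sqrt_pos.2 (by norm_num)
  have h66 : Real.sqrt 6 ^ 2 = 6 := Real.sq_sqrt (by norm_num)
  have h23 : Real.sqrt (2 / 3) = Real.sqrt 6 / 3 := by
    rw [show (2 / 3 : ℝ) = 6 / 3 ^ 2 by norm_num, Real.sqrt_div' _ (by norm_num), Real.sqrt_sq (by norm_num)]
  -- `‖a + b + c‖² = 6` and `⟪a + b + c, n⟫ = √6`, so `n = (a + b + c)/√6`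
  have h11 : ⟪a, a⟫_ℝ = 1 := by rw [real_inner_self_eq_norm_sq, norm_eq_one_of_mem_fccSlots ha, one_pow]
  have h22 : ⟪b, b⟫_ℝ = 1 := by rw [real_inner_self_eq_norm_sq, norm_eq_one_of_mem_fccSlots hb, one_pow]
  have h33 : ⟪c, c⟫_ℝ = 1 := by rw [real_inner_self_eq_norm_sq, norm_eq_one_of_mem_fccSlots hc, one_pow]
  have hs6 : ‖a + b + c‖ ^ 2 = 6 := by
    rw [← real_inner_self_eq_norm_sq]
    have hba : ⟪b, a⟫_ℝ = 1 / 2 := by rw [real_inner_comm]; exact hab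
    have hca : ⟪c, a⟫_ℝ = 1 / 2 := by rw [real_inner_comm]; exact hac
    have hcb : ⟪c, b⟫_ℝ = 1 / 2 := by rw [real_inner_comm]; exact hbc
    simp only [inner_add_left, inner_add_right, h11, h22, h33, hab, hac, hbc, hba, hca, hcb]
    norm_num
  have hsn : ⟪a + b + c, n⟫_ℝ = Real.sqrt 6 := by
    rw [inner_add_left, inner_add_left, hna, hnb, hnc, h23]; ring
  have hnorm : ‖a + b + c‖ = Real.sqrt 6 := by
    rw [← Real.sqrt_sq (norm_nonneg _), hs6]
  have key : n = (Real.sqrt 6)⁻¹ • (a + b + c) := by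
    -- equality in Cauchy–Schwarz
    have hcs : ⟪a + b + c, n⟫_ℝ = ‖a + b + c‖ * ‖n‖ := by rw [hsn, hnorm, hn, mul_one]
    have := (inner_eq_norm_mul_iff_real).1 hcs
    rw [hn, one_smul, hnorm] at this
    rw [this, smul_smul, inv_mul_cancel₀ h6.ne', one_smul]
  rw [modelNormals, mem_image]
  exact ⟨((a, b), c), mem_filter.2 ⟨mem_product.2 ⟨mem_product.2 ⟨ha, hb⟩, hc⟩, hab, hac, hbc⟩, key.symm⟩

/-- The other standard frame is the basal mirror of this one. -/
theorem sigFrame_not_apply (ε : Bool) (x : EuclideanSpace ℝ (Fin 3)) : sigFrame (!ε) x = basalMirror (sigFrame ε x) := by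
  cases ε
  · rfl
  · change x = basalMirror (basalMirror x); rw [basalMirror_basalMirror]

/-- Hence its slot dozen is the basal mirror image. -/
theorem image_sigFrame_not (ε : Bool) :
    (sigFrame (!ε) : EuclideanSpace ℝ (Fin 3) → EuclideanSpace ℝ (Fin 3)) '' ↑fccSlots =
      (basalMirror : EuclideanSpace ℝ (Fin 3) → EuclideanSpace ℝ (Fin 3)) ''
        ((sigFrame ε : EuclideanSpace ℝ (Fin 3) → EuclideanSpace ℝ (Fin 3)) '' ↑fccSlots) := by
  rw [Set.image_image]
  exact Set.image_congr fun x _ => sigFrame_not_apply ε x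

/-- Both standard frames are involutions. -/
theorem sigFrame_symm_apply (ε : Bool) (x : EuclideanSpace ℝ (Fin 3)) : (sigFrame ε).symm x = sigFrame ε x := by
  cases ε
  · rfl
  · apply (sigFrame true).injective
    rw [LinearIsometryEquiv.apply_symm_apply]
    change x = basalMirror (basalMirror x)
    rw [basalMirror_basalMirror]

/-- Both standard frames fix the basal vectors. -/
theorem sigFrame_of_basal (ε : Bool) {x : EuclideanSpace ℝ (Fin 3)} (hx : x 2 = 0) : sigFrame ε x = x := by
  cases ε
  · rfl
  · exact basalMirror_of_inPlane hx

/-- Third coordinate under a standard frame: zero iff zero. -/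
theorem sigFrame_apply_two_eq_zero_iff (ε : Bool) (x : EuclideanSpace ℝ (Fin 3)) : (sigFrame ε x) 2 = 0 ↔ x 2 = 0 := by
  cases ε
  · rfl
  · change (basalMirror x) 2 = 0 ↔ x 2 = 0
    rw [basalMirror_apply_coord]; simp

/-- The standard frames are slot-dozen standard. -/
theorem image_sigFrame_std (ε : Bool) :
    (sigFrame ε : EuclideanSpace ℝ (Fin 3) → EuclideanSpace ℝ (Fin 3)) '' ↑fccSlots = ↑fccSlots ∨
      (sigFrame ε : EuclideanSpace ℝ (Fin 3) → EuclideanSpace ℝ (Fin 3)) '' ↑fccSlots =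
        (basalMirror : EuclideanSpace ℝ (Fin 3) → EuclideanSpace ℝ (Fin 3)) '' ↑fccSlots := by
  cases ε
  · left; exact Set.image_id _
  · right; rfl

/-- A standard frame is one of the two standard frames up to its slot dozen. -/
theorem exists_sigFrame_of_std {F : EuclideanSpace ℝ (Fin 3) ≃ₗᵢ[ℝ] EuclideanSpace ℝ (Fin 3)}
    (hF : (F : EuclideanSpace ℝ (Fin 3) → EuclideanSpace ℝ (Fin 3)) '' ↑fccSlots = ↑fccSlots ∨
      (F : EuclideanSpace ℝ (Fin 3) → EuclideanSpace ℝ (Fin 3)) '' ↑fccSlots =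
        (basalMirror : EuclideanSpace ℝ (Fin 3) → EuclideanSpace ℝ (Fin 3)) '' ↑fccSlots) :
    ∃ ε : Bool, (F : EuclideanSpace ℝ (Fin 3) → EuclideanSpace ℝ (Fin 3)) '' ↑fccSlots =
      (sigFrame ε : EuclideanSpace ℝ (Fin 3) → EuclideanSpace ℝ (Fin 3)) '' ↑fccSlots := by
  rcases hF with h | h
  · exact ⟨false, by rw [h]; exact (Set.image_id _).symm⟩
  · exact ⟨true, h⟩

/-- The signature direction of a slot signature is a unit vector. -/
theorem norm_sigDir {ε : Bool} {w : EuclideanSpace ℝ (Fin 3)} (hw : w ∈ fccSlots) : ‖sigDir (ε, w)‖ = 1 := by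
  unfold sigDir
  rw [LinearIsometryEquiv.norm_map, norm_eq_one_of_mem_fccSlots hw]

/-- The frames of a plate system depend on the base frame only. -/
theorem PlateSystem.fw_eq_of_G₀ {S S' : PlateSystem} (h : S.G₀ = S'.G₀) : ∀ κ, S.Fw κ = S'.Fw κ := by
  intro κ
  induction κ with
  | nil => exact h
  | cons μ κ ih => rw [PlateSystem.fw_cons, PlateSystem.fw_cons, ih]

/-- `inPlaneRoots` are basal slots. -/
theorem inPlaneRoots_subset_basalHexagon (L : EuclideanSpace ℝ (Fin 3) ≃ₗᵢ[ℝ] EuclideanSpace ℝ (Fin 3)) (s : ℝ) :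
    inPlaneRoots L s ⊆ basalHexagon := by
  intro r hr
  rw [inPlaneRoots, mem_filter] at hr
  exact mem_filter.2 ⟨hr.1, hr.2.1⟩

/-- The half-turn negates basal vectors. -/
theorem halfTurn_of_basal {r : EuclideanSpace ℝ (Fin 3)} (hr : r 2 = 0) :
    (ℝ ∙ EuclideanSpace.single (2 : Fin 3) (1 : ℝ)).reflection r = -r := by
  rw [halfTurn_apply, hr, mul_zero, zero_smul, zero_sub]

/-- The top plate's falling roots are the bottom plate's rising roots (as model sets). -/
theorem inPlaneRoots_halfTurn (L : EuclideanSpace ℝ (Fin 3) ≃ₗᵢ[ℝ] EuclideanSpace ℝ (Fin 3)) :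
    inPlaneRoots (((ℝ ∙ EuclideanSpace.single (2 : Fin 3) (1 : ℝ)).reflection).trans L) (-1) = inPlaneRoots L 1 := by
  unfold inPlaneRoots
  refine filter_congr fun r _ => ?_
  constructor
  · rintro ⟨hr, hpos⟩
    rw [LinearIsometryEquiv.trans_apply, halfTurn_of_basal hr, map_neg] at hpos
    refine ⟨hr, ?_⟩
    have : (-(L r)) 2 = -((L r) 2) := rfl
    rw [this] at hpos; linarith
  · rintro ⟨hr, hpos⟩
    refine ⟨hr, ?_⟩
    rw [LinearIsometryEquiv.trans_apply, halfTurn_of_basal hr, map_neg]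
    have : (-(L r)) 2 = -((L r) 2) := rfl
    rw [this]; linarith

/-- **Sector lemma**: the basal slots on the positive side of any vector lie in ONE basal sector. -/
theorem exists_sector_of_halfplane (u : EuclideanSpace ℝ (Fin 3)) :
    ∃ h ∈ basalHexagon, ∀ w ∈ basalHexagon, 0 < ⟪w, u⟫_ℝ → 0 < ⟪w, h⟫_ℝ := by
  classical
  have hne : basalHexagon.Nonempty := by
    refine ⟨barlowPos 1 (Real.sqrt (2 / 3)) constHagg 0 1 0, mem_filter.2 ⟨barlowPos_mem_fccSlots (by decide), ?_⟩⟩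
    rw [barlowPos_apply_two]; simp
  obtain ⟨h, hh, hmax⟩ := exists_max_image basalHexagon (fun w => ⟪w, u⟫_ℝ) hne
  refine ⟨h, hh, fun w hw hpos => ?_⟩
  obtain ⟨hhS, hh2⟩ := mem_filter.1 hh
  obtain ⟨hwS, hw2⟩ := mem_filter.1 hw
  have he : ‖EuclideanSpace.single (2 : Fin 3) (1 : ℝ)‖ = 1 := by rw [PiLp.norm_single, norm_one]
  have hmenu : ∀ w ∈ fccSlots,
      ⟪(LinearIsometryEquiv.refl ℝ (EuclideanSpace ℝ (Fin 3))) w, EuclideanSpace.single (2 : Fin 3) (1 : ℝ)⟫_ℝ = 0 ∨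
      ⟪(LinearIsometryEquiv.refl ℝ (EuclideanSpace ℝ (Fin 3))) w, EuclideanSpace.single (2 : Fin 3) (1 : ℝ)⟫_ℝ =
        Real.sqrt (2 / 3) ∨
      ⟪(LinearIsometryEquiv.refl ℝ (EuclideanSpace ℝ (Fin 3))) w, EuclideanSpace.single (2 : Fin 3) (1 : ℝ)⟫_ℝ =
        -Real.sqrt (2 / 3) := by
    intro w hw; rw [LinearIsometryEquiv.coe_refl, id, inner_single_two_one]; exact slot_apply_two_cases hw
  rcases inner_slots_mem hwS hhS with hi | hi | hi | hi | hi
  · rw [hi]; exact one_pos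
  · rw [hi]; norm_num
  · exact absurd hi (inner_inPlane_slots_ne_zero (LinearIsometryEquiv.refl ℝ _) he hmenu hwS hhS
      (by rw [LinearIsometryEquiv.coe_refl, id, inner_single_two_one, hw2])
      (by rw [LinearIsometryEquiv.coe_refl, id, inner_single_two_one, hh2]))
  · -- `w + h` is a basal slot reading more than the maximum: absurd
    exfalso
    have hsum : w - -h ∈ fccSlots :=
      sub_mem_fccSlots_of_inner_eq_half hwS (neg_mem_fccSlots hhS) (by rw [inner_neg_right, hi]; norm_num)
    rw [sub_neg_eq_add] at hsum
    have hsum2 : (w + h) 2 = 0 := by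
      change w 2 + h 2 = 0
      rw [hw2, hh2, add_zero]
    have := hmax (w + h) (mem_filter.2 ⟨hsum, hsum2⟩)
    rw [inner_add_left] at this
    linarith
  · exfalso
    have hhw : h = -w := eq_neg_of_inner_eq_neg_one' (norm_eq_one_of_mem_fccSlots hwS) (norm_eq_one_of_mem_fccSlots hhS) hi
    have := hmax w hw
    rw [hhw, inner_neg_left] at this
    linarith

end Summit.Ventures.Crystal3D.Theorems

end
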